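import Summits.Ventures.PercRepro.C026AcyclicPhi
import Summits.Ventures.PercRepro.C026FactorTwo

/-!
# Forests satisfy the factor-2 and symmetric strengthenings of C-026 (p6, gen 10)

mine-3's stronger forms of the class inequality (dossier §12; p5's `C026FactorTwo.lean`): **S7**
`TwoTimesIneq` (`2·#BotM ≤ #ac|b + #bc|a`, the class form of `Q3½`), **S8** `FactorTwoDFree`
(`2·#KL ≤ #Kc + #Lc`, `KL` = `BotM` with neither offer) and the symmetric strengthening `(★′)`
`StarPrimeIneq`.  On acyclic marked multigraphs all three hold:

* `KLWitness.not_botM_T` — the image `T` of the injection `Φ` (second case) is NOT in `BotM`: by Claim 1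
  a vertex of `M_T = M_c` would carry closed edges to both `K_T` and `L_T`, but the only carrier to `L` in `S`
  is `x ∉ M_c` (U1);
* hence `Φ` maps the residual `KL` into `Kc = bot ∧ ¬bad ∧ O1` (`phi_mem_kc`), injectively:
  `#KL ≤ #Kc`; the `a ↔ b` mirror gives `#KL ≤ #Lc`; so **`Acyclic.factorTwoDFree`** and, by p5's
  `starPrime_of_factorTwo`, **`Acyclic.starPrimeIneq`**;
* `#BotM ≤ #O1 ≤ #ac|b` and its mirror give **`Acyclic.twoTimesIneq`**; the products of the one-sided
  bounds give the Cauchy–Schwarz forms **S9** `Acyclic.csResidualIneq` (`#KL² ≤ #Kc·#Lc`) and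
  `Acyclic.csIneq` (`#BotM² ≤ #ac|b·#bc|a`).
-/

namespace PercRepro

open Finset

namespace MultiGraph

variable {V E : Type*} {G : MultiGraph V E}

/-! ### Symmetry in `a ↔ b` -/

/-- `IsBot` is symmetric in `a, b`. -/
theorem isBot_swap_iff (ω : Config E) (a b c : V) : G.IsBot ω b a c ↔ G.IsBot ω a b c := by
  unfold IsBot
  rw [conn_comm (u := b) (v := a)]
  tauto

/-- `BotM` is symmetric in `a, b`. -/
theorem botM_swap_iff (ω : Config E) (a b c : V) : G.BotM ω b a c ↔ G.BotM ω a b c := by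
  unfold BotM
  rw [isBot_swap_iff, conn_comm (u := b) (v := a)]

/-- `BadM` is symmetric in `a, b`. -/
theorem badM_swap_iff (ω : Config E) (a b c : V) : G.BadM ω b a c ↔ G.BadM ω a b c := by
  unfold BadM IsCIso
  rw [conn_comm (u := b) (v := a)]
  tauto

/-- The first offer of `(b, a, c)` is the second offer of `(a, b, c)`. -/
theorem o1_swap_iff (ω : Config E) (a b c : V) : G.O1 ω b a c ↔ G.O2 ω a b c := by
  unfold O1 O2 CellAC CellBC
  rw [isBot_swap_iff, conn_comm (u := b) (v := a)]

/-- The residual `KL` is symmetric in `a, b`. -/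
theorem kl_swap_iff (ω : Config E) (a b c : V) : G.KL ω b a c ↔ G.KL ω a b c := by
  unfold KL
  rw [botM_swap_iff, o1_swap_iff, ← o1_swap_iff ω b a c]
  tauto

/-- `Lc` of `(a, b, c)` is `Kc` of `(b, a, c)`. -/
theorem kc_swap_iff (ω : Config E) (a b c : V) : G.Kc ω b a c ↔ G.Lc ω a b c := by
  unfold Kc Lc
  rw [isBot_swap_iff, badM_swap_iff, o1_swap_iff]

/-! ### The image `T` is not in `BotM` -/

namespace KLWitness

variable [DecidableEq E] {S : Config E} {a b c : V} (w : G.KLWitness S a b c)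

/-- **`T ∉ BotM`**: in `T` no vertex of `M_T` carries a closed edge to `L_T` (the only carrier to `L` in
`S` is `x`, which now lies in `K_T`), so `a ≁ b` in the `M`-flip of `T` by Claim 1. -/
theorem not_botM_T (hG : G.Acyclic) (hbot : G.IsBot S a b c) : ¬ G.BotM w.T a b c := by
  rintro ⟨hbotT, hKL⟩
  obtain ⟨y, hcy, -, g, z, hgT, hjg, hbz⟩ := hG.exists_carrier hbotT hKL
  have hbz' : G.Conn S b z := w.conn_S_b_of_conn_T hbot hbz
  have hgK : g ≠ w.eK := fun h => by rw [h, w.T_eK] at hgT; exact absurd hgT (by decide)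
  have hg₁ : g ≠ w.e₁ := by
    intro h
    subst h
    rcases JoinsV.eq_or_eq w.hj₁ hjg with ⟨-, h2⟩ | ⟨h1, -⟩
    · -- `z = y₁ ∈ K_T`, but `z ∈ L`
      have : G.Conn S b w.x :=
        hbz'.trans ((h2 ▸ (G.conn_update_false w.hy₁) : G.Conn S z w.x))
      exact hbot.2.2 (this.trans w.hcx.symm)
    · exact hbot.2.2 (h1 ▸ hbz')
  have hgS : S g = false := by rw [← w.T_apply_of_ne hg₁ hgK]; exact hgT
  -- `y ∈ M_T ⊆ M` in `S`
  have hcy' : G.Conn S c y := by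
    rcases (w.conn_T_iff c y).1 hcy with h | ⟨h, -⟩ | ⟨h, -⟩
    · exact G.conn_update_false h
    · exact absurd h.symm (w.not_conn_S₁_x_c hG)
    · exact absurd (G.conn_update_false h) (fun h' => hbot.2.1 (w.huK.trans h'.symm))
  -- `y` and `x` both carry closed edges to `L` in `S`: the same edge, so `y = x`, but `x ∉ M_T`
  have hyx : y = w.x := by
    by_cases hgL : g = w.eL
    · subst hgL
      rcases JoinsV.eq_or_eq hjg w.hjL with ⟨h1, -⟩ | ⟨h1, -⟩
      · exact h1
      · have hby : G.Conn S b y := by rw [h1]; exact w.huL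
        exact absurd hby (fun h => hbot.2.2 (h.trans hcy'.symm))
    · exact absurd (hG.not_two_closed' hgS hgL hjg w.hjL (hcy'.symm.trans w.hcx)
        (hbz'.symm.trans w.huL)) id
  subst hyx
  exact hbotT.2.1 ((w.conn_T_a_x hbot).trans hcy.symm)

end KLWitness

/-! ### The factor-2 inequalities -/

section FactorTwo

variable [DecidableEq E] (hG : G.Acyclic) (a b c : V)
include hG

/-- On the residual `KL` the injection `Φ` takes the second case and lands in `Kc`. -/
theorem phi_mem_kc {S : Config E} (hS : G.KL S a b c) : G.Kc (G.phi hG a b c S) a b c := by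
  have hc : ¬ G.Carries S c a := fun h => hS.2.1 ⟨hS.1.1, G.cellAC_kSwapSealed_of_carries hS.1.1 h⟩
  have h : G.BotM S a b c ∧ ¬ G.Carries S c a := ⟨hS.1, hc⟩
  rw [G.phi_of_pos hG a b c h]
  set w := G.klWitness hG a b c h
  have hbotT := w.isBot_T hG hS.1.1
  refine ⟨hbotT, fun hbad => w.not_botM_T hG hS.1.1 ⟨hbotT, hbad.2⟩,
    hbotT, G.cellAC_kSwapSealed_of_carries hbotT (w.carries_T_c_a hS.1.1)⟩

open Classical in
/-- `#KL ≤ #Kc` on an acyclic multigraph. -/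
theorem Acyclic.card_kl_le_card_kc [Fintype E] :
    (Finset.univ.filter fun ω : Config E => G.KL ω a b c).card ≤
      (Finset.univ.filter fun ω : Config E => G.Kc ω a b c).card := by
  refine Finset.card_le_card_of_injOn (G.phi hG a b c) ?_ ?_
  · intro S hS
    simp only [Finset.coe_filter, Finset.mem_univ, true_and, Set.mem_setOf_eq] at hS ⊢
    exact G.phi_mem_kc hG a b c hS
  · intro S hS S' hS' h
    simp only [Finset.coe_filter, Finset.mem_univ, true_and, Set.mem_setOf_eq] at hS hS'
    exact G.phi_inj hG a b c hS.1 hS'.1 h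

open Classical in
/-- `#KL ≤ #Lc` on an acyclic multigraph (the `a ↔ b` mirror). -/
theorem Acyclic.card_kl_le_card_lc [Fintype E] :
    (Finset.univ.filter fun ω : Config E => G.KL ω a b c).card ≤
      (Finset.univ.filter fun ω : Config E => G.Lc ω a b c).card := by
  have h := Acyclic.card_kl_le_card_kc hG b a c
  simp only [kl_swap_iff, kc_swap_iff] at h
  exact h

open Classical in
/-- **S8 on forests**: `2·#KL ≤ #Kc + #Lc`. -/
theorem Acyclic.factorTwoDFree [Fintype E] : G.FactorTwoDFree a b c := by
  unfold FactorTwoDFree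
  have h1 := Acyclic.card_kl_le_card_kc hG a b c
  have h2 := Acyclic.card_kl_le_card_lc hG a b c
  omega

/-- **`(★′)` on forests**: mine-3's symmetric strengthening of the D-free inequality. -/
theorem Acyclic.starPrimeIneq [Fintype E] : G.StarPrimeIneq a b c :=
  G.starPrime_of_factorTwo (Acyclic.factorTwoDFree hG a b c)

open Classical in
/-- `#BotM ≤ #ac|b` on an acyclic multigraph (the one-sided form, then the injective sealed flip). -/
theorem Acyclic.card_botM_le_cellAC [Fintype E] :
    (Finset.univ.filter fun ω : Config E => G.BotM ω a b c).card ≤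
      (Finset.univ.filter fun ω : Config E => G.Conn ω a c ∧ ¬ G.Conn ω a b).card :=
  (Acyclic.card_botM_le hG a b c).trans
    (card_filter_le_of_injective (G.kSwapSealed c b) (G.kSwapSealed_injective c b)
      (fun ω => G.IsBot ω a b c ∧ G.CellAC (G.kSwapSealed c b ω) a b c)
      (fun ω => G.Conn ω a c ∧ ¬ G.Conn ω a b) (fun _ hω => hω.2))

open Classical in
/-- **S7 on forests**: `2·#BotM ≤ #ac|b + #bc|a` — the class form of `Q3½`. -/
theorem Acyclic.twoTimesIneq [Fintype E] : G.TwoTimesIneq a b c := by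
  unfold TwoTimesIneq
  have h1 := Acyclic.card_botM_le_cellAC hG a b c
  have h2 := Acyclic.card_botM_le_cellAC hG b a c
  simp only [botM_swap_iff] at h2
  have h3 : (Finset.univ.filter fun ω : Config E => G.Conn ω b c ∧ ¬ G.Conn ω b a).card =
      (Finset.univ.filter fun ω : Config E => G.Conn ω b c ∧ ¬ G.Conn ω a b).card := by
    congr 1
    ext ω
    simp only [Finset.mem_filter, Finset.mem_univ, true_and]
    rw [conn_comm (u := b) (v := a)]
  rw [h3] at h2
  omega

open Classical in
/-- **S9 (residual form) on forests**: `#KL² ≤ #Kc · #Lc` — the product of the two one-sided bounds. -/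
theorem Acyclic.csResidualIneq [Fintype E] : G.CSResidualIneq a b c := by
  unfold CSResidualIneq
  rw [sq]
  exact Nat.mul_le_mul (Acyclic.card_kl_le_card_kc hG a b c) (Acyclic.card_kl_le_card_lc hG a b c)

open Classical in
/-- **S9 on forests**: `#BotM² ≤ #ac|b · #bc|a` — the product of the two one-sided bounds. -/
theorem Acyclic.csIneq [Fintype E] : G.CSIneq a b c := by
  unfold CSIneq
  rw [sq]
  refine Nat.mul_le_mul (Acyclic.card_botM_le_cellAC hG a b c) ?_
  have h2 := Acyclic.card_botM_le_cellAC hG b a c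
  simp only [botM_swap_iff] at h2
  have h3 : (Finset.univ.filter fun ω : Config E => G.Conn ω b c ∧ ¬ G.Conn ω b a).card =
      (Finset.univ.filter fun ω : Config E => G.Conn ω b c ∧ ¬ G.Conn ω a b).card := by
    congr 1
    ext ω
    simp only [Finset.mem_filter, Finset.mem_univ, true_and]
    rw [conn_comm (u := b) (v := a)]
  rw [h3] at h2
  exact h2

end FactorTwo

end MultiGraph

end PercRepro
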